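import Literature.MathematicalPhysics.QuantumFieldTheory.Federbush1986.CubeCutoffs

/-!
# `Federbush1986.CubeRadialProjection` — [Federbush1988PhaseCellIV] §11 Geometric Construction 6 (11.12)–(11.13) p. 338–339 /
# Theorem A.4 (A.38) p. 343 ON THE UNIT `k`-CUBE: the radial projection `π_{x₀}` from an interior point `x₀` onto `∂H` (the
# integrand «`f((y − x₀)/|y − x₀| + x₀)`» of (A.38) with the sphere replaced by the boundary of the hypercube) — Minkowski gauge,
# boundary values, and the Lipschitz bound away from `x₀` — PROVED

statement-level skeleton of published theorems with citation tags; proofs where landed; nothing here is a claim about the Yang–Mills mass gap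

CITATION HEADER.  P. Federbush, *A phase cell approach to Yang–Mills theory. IV. The choice of variables*, Commun. Math.
Phys. **114** (1988) 317–343 [Federbush1988PhaseCellIV], §11 p. 338–339: «We finally consider `φ′(x)` defined on `∂H` of
hypercube `H` where `φ′` is not a homotopically trivial map from `∂H` to `G`.  In this case we find an extension, discontinuous at
one point `x₀`. … *Geometric Construction 6.* `ᵉφ′(x)` defined on `H − x₀`, as an extension of `φ′(x)` defined on `∂H` …», and
Appendix A part D, Theorem A.4 with its proof (A.37)–(A.38) p. 343: «`f_ε(x) = ∫ dy w^{εd′(x)}(x − y) f((y − x₀)/|y − x₀| + x₀)`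
(A.38)» (renders f4-p022/f4-p023/f4-p027 of unit `lit-balaban-r19`, read as images).  Cell `lit-balaban`, Phase-2 proof
seat **r19 gen 11** (F4 fold owner); SKELETON row **F4.Def§11**, cell Geometric Construction 6 (decl
`PhaseCellIVGauge.GeomConstruction6`, typed p314251) — engine 1/2 of its proof (2/2 `PhaseCellIVGeomConstruction6`).  Inputs
BY NAME: `CubeCutoffs` (r19 g11: `msize`, `abs_apply_sub_le_dist`), `PhaseCellIVGeomConstruction4` (p266275:
`CubeBall.mem_cubeBoundary_iff`, `supN`, `norm_le_sqrt_mul_supN`), Mathlib `LipschitzOnWith.extend_finite_dimension`.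

WHAT IS PRINTED AND WHAT IS DONE HERE.  For the ball print extends the datum `f : ∂B → M` to `B − x₀` along rays,
`y ↦ f((y − x₀)/|y − x₀| + x₀)` (A.38), a map that is `0`-homogeneous about `x₀` and Lipschitz away from `x₀`; Construction 6 is
this on a hypercube `H` with `x₀` near the centre (Centering Property p. 338).  On the cube the ray from `x₀` through `y`
leaves `H` at `π_{x₀}(y) = x₀ + (y − x₀)/τ_{x₀}(y)`, `τ_{x₀}` the Minkowski gauge of `H − x₀`,
`τ_{x₀}(y) = max_i max((y_i − x₀,i)/(1 − x₀,i), (x₀,i − y_i)/x₀,i)`.  THIS FILE proves, for `x₀` with all face distances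
`≥ μ > 0`: `τ` is `μ^{−1}`-Lipschitz, `|y_i − x₀,i| ≤ τ(y)`, `|y − x₀| ≤ √k·τ(y)`; `π(y) ∈ ∂H` for `y ≠ x₀`; `τ = 1` and `π = id`
on `∂H`, `τ ≤ 1` on `H`; and **`π` is Lipschitz on `{|y − x₀| ≥ a}` with constant `(√k/a)(1 + √k/μ)`** — so that `φ′ ∘ π` is the
Lipschitz, `M`-valued, `0`-homogeneous extension of the datum that gets mollified in `PhaseCellIVGeomConstruction6`.  Also a
McShane-type extension lemma for data on an arbitrary subset (`exists_lipschitz_extension_of_set`).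

WHAT THIS MODULE PROVIDES (namespace `CubeRadial`, `k ≥ 1` via `[NeZero k]`): defs with bodies `ratio`, `gauge` (`τ_{x₀}`),
`proj` (`π_{x₀}`); theorems `ratio_nonneg`, `abs_sub_le_ratio`, `ratio_le_gauge`, `exists_gauge_eq`, `gauge_nonneg`,
`abs_sub_le_gauge`, `supN_sub_le_gauge`, `norm_sub_le_sqrt_mul_gauge`, `gauge_pos`, `gauge_le_gauge_add`, `gauge_le_one`,
`gauge_eq_one`, `proj_mem_cubeBoundary`, `proj_eq_self`, **`dist_proj_le`**, `lipschitzOnWith_proj`,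
`exists_lipschitz_extension_of_set`.  No `Prop`-valued definition, no named fact; axioms standard.  v1.1 (r19 g11, docfix
only): the (A.38) quotation above now reads `f_ε(x) = …` as printed on p. 343 (v1 p323585 wrote `f^{es′}_ε(x)`), and one
unquoted paraphrase lost its guillemets; every declaration byte-identical with v1.
-/

namespace Literature.MathematicalPhysics.QuantumFieldTheory.Federbush1986

noncomputable section

open Metric Set Filter Function Real
open scoped Topology NNReal

namespace CubeRadial

open LipschitzMollifier (Euc)
open PhaseCellIVAppA (unitCube cubeBoundary cubeBoundary_subset)
open PhaseCellIVAppA.CubeBall (mem_cubeBoundary_iff supN supN_nonneg abs_apply_le_supN norm_le_sqrt_mul_supN)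
open CubeCutoffs (univ_nonempty abs_apply_sub_le_dist)

variable {k : ℕ}

/-! ## §1 The Minkowski gauge `τ_{x₀}` of `H − x₀` -/

/-- The exit ratio of the `i`-th coordinate: `max((y_i − x₀,i)/(1 − x₀,i), (x₀,i − y_i)/x₀,i)`.
[cite: Federbush1988PhaseCellIV, (A.38) p. 343; Geometric Construction 6 p. 338] -/
def ratio (x₀ y : Euc k) (i : Fin k) : ℝ := max ((y i - x₀ i) / (1 - x₀ i)) ((x₀ i - y i) / x₀ i)

/-- **The Minkowski gauge** `τ_{x₀}(y) = max_i ratio_i`: the ray `x₀ + s(y − x₀)` leaves the cube at `s = 1/τ_{x₀}(y)`.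
[cite: Federbush1988PhaseCellIV, (A.38) p. 343; Geometric Construction 6 p. 338] -/
def gauge [NeZero k] (x₀ y : Euc k) : ℝ := Finset.univ.sup' univ_nonempty (ratio x₀ y)

/-- **The radial projection onto `∂H`**, `π_{x₀}(y) = x₀ + (y − x₀)/τ_{x₀}(y)` — print's `(y − x₀)/|y − x₀| + x₀` of (A.38) with
the sphere replaced by the boundary of the hypercube. [cite: Federbush1988PhaseCellIV, (A.38) p. 343; Geometric Construction 6
p. 338] -/
def proj [NeZero k] (x₀ y : Euc k) : Euc k := x₀ + (gauge x₀ y)⁻¹ • (y - x₀)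

section Gauge

variable [NeZero k] {x₀ : Euc k} {μ : ℝ} (hμ : 0 < μ) (hμ₀ : ∀ i, μ ≤ x₀ i) (hμ₁ : ∀ i, μ ≤ 1 - x₀ i)
include hμ hμ₀ hμ₁

omit [NeZero k] in
/-- Each exit ratio is `≥ 0` (the two numerators have opposite signs, the denominators are positive).
[cite: Federbush1988PhaseCellIV, (A.38) p. 343] -/
theorem ratio_nonneg (y : Euc k) (i : Fin k) : 0 ≤ ratio x₀ y i := by
  have h0 : 0 < x₀ i := hμ.trans_le (hμ₀ i)
  have h1 : 0 < 1 - x₀ i := hμ.trans_le (hμ₁ i)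
  unfold ratio
  rcases le_total (x₀ i) (y i) with h | h
  · exact le_max_of_le_left (div_nonneg (by linarith) h1.le)
  · exact le_max_of_le_right (div_nonneg (by linarith) h0.le)

omit [NeZero k] in
/-- `|y_i − x₀,i| ≤ ratio_i` (the denominators are `≤ 1`). [cite: Federbush1988PhaseCellIV, (A.38) p. 343] -/
theorem abs_sub_le_ratio (y : Euc k) (i : Fin k) : |y i - x₀ i| ≤ ratio x₀ y i := by
  have h0 : 0 < x₀ i := hμ.trans_le (hμ₀ i)
  have h1 : 0 < 1 - x₀ i := hμ.trans_le (hμ₁ i)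
  have h0' : x₀ i ≤ 1 := by linarith
  have h1' : 1 - x₀ i ≤ 1 := by linarith
  unfold ratio
  rcases le_total (x₀ i) (y i) with h | h
  · rw [abs_of_nonneg (by linarith)]
    exact le_max_of_le_left ((le_div_iff₀ h1).2 (by nlinarith))
  · rw [abs_of_nonpos (by linarith)]
    exact le_max_of_le_right ((le_div_iff₀ h0).2 (by nlinarith))

omit hμ hμ₀ hμ₁ in
/-- `ratio_i ≤ τ`. [cite: Federbush1988PhaseCellIV, (A.38) p. 343] -/
theorem ratio_le_gauge (x₀ y : Euc k) (i : Fin k) : ratio x₀ y i ≤ gauge x₀ y :=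
  Finset.le_sup' (ratio x₀ y) (Finset.mem_univ i)

omit hμ hμ₀ hμ₁ in
/-- The gauge is attained: `τ = ratio_i` for some `i`. [cite: Federbush1988PhaseCellIV, (A.38) p. 343] -/
theorem exists_gauge_eq (x₀ y : Euc k) : ∃ i, gauge x₀ y = ratio x₀ y i := by
  obtain ⟨i, -, hi⟩ := Finset.exists_mem_eq_sup' univ_nonempty (ratio x₀ y)
  exact ⟨i, hi⟩

/-- `τ ≥ 0`. [cite: Federbush1988PhaseCellIV, (A.38) p. 343] -/
theorem gauge_nonneg (y : Euc k) : 0 ≤ gauge x₀ y :=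
  (ratio_nonneg hμ hμ₀ hμ₁ y ⟨0, Nat.pos_of_ne_zero (NeZero.ne k)⟩).trans (ratio_le_gauge x₀ y _)

/-- `|y_i − x₀,i| ≤ τ(y)`. [cite: Federbush1988PhaseCellIV, (A.38) p. 343] -/
theorem abs_sub_le_gauge (y : Euc k) (i : Fin k) : |y i - x₀ i| ≤ gauge x₀ y :=
  (abs_sub_le_ratio hμ hμ₀ hμ₁ y i).trans (ratio_le_gauge x₀ y i)

/-- `|y − x₀|_∞ ≤ τ(y)`. [cite: Federbush1988PhaseCellIV, (A.38) p. 343] -/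
theorem supN_sub_le_gauge (y : Euc k) : supN (y - x₀) ≤ gauge x₀ y := by
  refine (pi_norm_le_iff_of_nonneg (gauge_nonneg hμ hμ₀ hμ₁ y)).mpr fun i => ?_
  rw [Real.norm_eq_abs]
  exact abs_sub_le_gauge hμ hμ₀ hμ₁ y i

/-- `|y − x₀| ≤ √k·τ(y)`. [cite: Federbush1988PhaseCellIV, (A.38) p. 343] -/
theorem norm_sub_le_sqrt_mul_gauge (y : Euc k) : ‖y - x₀‖ ≤ Real.sqrt k * gauge x₀ y :=
  (norm_le_sqrt_mul_supN (y - x₀)).trans (mul_le_mul_of_nonneg_left (supN_sub_le_gauge hμ hμ₀ hμ₁ y) (Real.sqrt_nonneg _))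

/-- `τ(y) > 0` for `y ≠ x₀`. [cite: Federbush1988PhaseCellIV, (A.38) p. 343] -/
theorem gauge_pos {y : Euc k} (hy : y ≠ x₀) : 0 < gauge x₀ y := by
  have h1 : 0 < ‖y - x₀‖ := norm_pos_iff.2 (sub_ne_zero.2 hy)
  have h2 := norm_sub_le_sqrt_mul_gauge hμ hμ₀ hμ₁ y
  have h3 : 0 < Real.sqrt k * gauge x₀ y := lt_of_lt_of_le h1 h2
  by_contra h
  exact absurd h3 (not_lt.2 (mul_nonpos_of_nonneg_of_nonpos (Real.sqrt_nonneg _) (le_of_not_gt h)))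

/-- On `{|y − x₀| ≥ a}` the gauge is `≥ a/√k`. [cite: Federbush1988PhaseCellIV, (A.38) p. 343] -/
theorem le_gauge_of_le_norm {a : ℝ} {y : Euc k} (hy : a ≤ ‖y - x₀‖) : a / Real.sqrt k ≤ gauge x₀ y := by
  have hk : 0 < Real.sqrt k := Real.sqrt_pos.2 (by exact_mod_cast Nat.pos_of_ne_zero (NeZero.ne k))
  rw [div_le_iff₀ hk, mul_comm]
  exact hy.trans (norm_sub_le_sqrt_mul_gauge hμ hμ₀ hμ₁ y)

/-- **`τ` is `μ^{−1}`-Lipschitz**: `τ(y) ≤ τ(y′) + |y − y′|/μ`. [cite: Federbush1988PhaseCellIV, (A.38) p. 343] -/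
theorem gauge_le_gauge_add (y y' : Euc k) : gauge x₀ y ≤ gauge x₀ y' + μ⁻¹ * ‖y - y'‖ := by
  obtain ⟨i, hi⟩ := exists_gauge_eq x₀ y
  have h0 : 0 < x₀ i := hμ.trans_le (hμ₀ i)
  have h1 : 0 < 1 - x₀ i := hμ.trans_le (hμ₁ i)
  have hc : |y i - y' i| ≤ ‖y - y'‖ := by rw [← dist_eq_norm]; exact abs_apply_sub_le_dist y y' i
  have hri : ratio x₀ y i ≤ ratio x₀ y' i + μ⁻¹ * ‖y - y'‖ := by
    have key := abs_max_sub_max_le_max ((y i - x₀ i) / (1 - x₀ i)) ((x₀ i - y i) / x₀ i)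
      ((y' i - x₀ i) / (1 - x₀ i)) ((x₀ i - y' i) / x₀ i)
    have ha : |(y i - x₀ i) / (1 - x₀ i) - (y' i - x₀ i) / (1 - x₀ i)| ≤ μ⁻¹ * ‖y - y'‖ := by
      rw [← sub_div, abs_div, abs_of_pos h1, show y i - x₀ i - (y' i - x₀ i) = y i - y' i by ring, div_eq_inv_mul]
      exact mul_le_mul ((inv_le_inv₀ h1 hμ).2 (hμ₁ i)) hc (abs_nonneg _) (by positivity)
    have hb : |(x₀ i - y i) / x₀ i - (x₀ i - y' i) / x₀ i| ≤ μ⁻¹ * ‖y - y'‖ := by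
      rw [← sub_div, abs_div, abs_of_pos h0, show x₀ i - y i - (x₀ i - y' i) = -(y i - y' i) by ring, abs_neg,
        div_eq_inv_mul]
      exact mul_le_mul ((inv_le_inv₀ h0 hμ).2 (hμ₀ i)) hc (abs_nonneg _) (by positivity)
    have := (le_abs_self _).trans (key.trans (max_le ha hb))
    unfold ratio
    linarith
  rw [hi]
  exact hri.trans (add_le_add (ratio_le_gauge x₀ y' i) le_rfl)

/-- `|τ(y) − τ(y′)| ≤ |y − y′|/μ`. [cite: Federbush1988PhaseCellIV, (A.38) p. 343] -/
theorem abs_gauge_sub_gauge_le (y y' : Euc k) : |gauge x₀ y - gauge x₀ y'| ≤ μ⁻¹ * ‖y - y'‖ := by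
  rw [abs_le]
  have h1 := gauge_le_gauge_add hμ hμ₀ hμ₁ y y'
  have h2 := gauge_le_gauge_add hμ hμ₀ hμ₁ y' y
  rw [norm_sub_rev] at h2
  constructor <;> linarith

/-- On the cube `τ ≤ 1`. [cite: Federbush1988PhaseCellIV, (A.38) p. 343; Geometric Construction 6 p. 338] -/
theorem gauge_le_one {y : Euc k} (hy : y ∈ unitCube k) : gauge x₀ y ≤ 1 := by
  refine Finset.sup'_le _ _ fun i _ => ?_
  have h0 : 0 < x₀ i := hμ.trans_le (hμ₀ i)
  have h1 : 0 < 1 - x₀ i := hμ.trans_le (hμ₁ i)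
  have hyi := hy i
  unfold ratio
  refine max_le ((div_le_one h1).2 (by linarith [hyi.2])) ((div_le_one h0).2 (by linarith [hyi.1]))

/-- On `∂H`, `τ = 1`. [cite: Federbush1988PhaseCellIV, (11.12) p. 338; (A.35) p. 343] -/
theorem gauge_eq_one {y : Euc k} (hy : y ∈ cubeBoundary k) : gauge x₀ y = 1 := by
  obtain ⟨hyD, i, hi⟩ := mem_cubeBoundary_iff.mp hy
  refine le_antisymm (gauge_le_one hμ hμ₀ hμ₁ hyD) ((le_of_eq ?_).trans (ratio_le_gauge x₀ y i))
  have h0 : 0 < x₀ i := hμ.trans_le (hμ₀ i)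
  have h1 : 0 < 1 - x₀ i := hμ.trans_le (hμ₁ i)
  unfold ratio
  rcases hi with hi | hi <;> rw [hi]
  · rw [zero_sub, sub_zero, div_self h0.ne']
    exact (max_eq_right ((div_le_one h1).2 (by linarith))).symm
  · rw [div_self h1.ne']
    exact (max_eq_left ((div_le_one h0).2 (by linarith))).symm

/-! ## §2 The radial projection `π_{x₀}` -/

omit hμ hμ₀ hμ₁ in
/-- The coordinates of `π(y)`. [cite: Federbush1988PhaseCellIV, (A.38) p. 343] -/
theorem proj_apply (y : Euc k) (i : Fin k) : proj x₀ y i = x₀ i + (gauge x₀ y)⁻¹ * (y i - x₀ i) := by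
  simp [proj]

/-- **`π(y) ∈ ∂H` for `y ≠ x₀`** (every coordinate of `π(y)` lies in `[0, 1]`, the maximising one on a face).
[cite: Federbush1988PhaseCellIV, (A.38) p. 343; Geometric Construction 6 p. 338] -/
theorem proj_mem_cubeBoundary {y : Euc k} (hy : y ≠ x₀) : proj x₀ y ∈ cubeBoundary k := by
  have hτ : 0 < gauge x₀ y := gauge_pos hμ hμ₀ hμ₁ hy
  rw [mem_cubeBoundary_iff]
  -- the `i`-th coordinate of `π(y)` is in `[0,1]`
  have hcoord : ∀ i, proj x₀ y i ∈ Icc (0 : ℝ) 1 := by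
    intro i
    have h0 : 0 < x₀ i := hμ.trans_le (hμ₀ i)
    have h1 : 0 < 1 - x₀ i := hμ.trans_le (hμ₁ i)
    rw [proj_apply]
    have hr := ratio_le_gauge x₀ y i
    unfold ratio at hr
    rcases le_total (x₀ i) (y i) with h | h
    · -- `y_i ≥ x₀,i`: `0 ≤ (y_i − x₀,i)/τ ≤ 1 − x₀,i`
      have ha : (y i - x₀ i) / (1 - x₀ i) ≤ gauge x₀ y := (le_max_left _ _).trans hr
      have hb : (gauge x₀ y)⁻¹ * (y i - x₀ i) ≤ 1 - x₀ i := by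
        rw [inv_mul_le_iff₀ hτ]
        rw [div_le_iff₀ h1] at ha
        linarith
      constructor
      · have : 0 ≤ (gauge x₀ y)⁻¹ * (y i - x₀ i) := mul_nonneg (inv_nonneg.2 hτ.le) (by linarith)
        linarith
      · linarith
    · -- `y_i ≤ x₀,i`: `−x₀,i ≤ (y_i − x₀,i)/τ ≤ 0`
      have ha : (x₀ i - y i) / x₀ i ≤ gauge x₀ y := (le_max_right _ _).trans hr
      have hb : (gauge x₀ y)⁻¹ * (x₀ i - y i) ≤ x₀ i := by
        rw [inv_mul_le_iff₀ hτ]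
        rw [div_le_iff₀ h0] at ha
        linarith
      have hb' : (gauge x₀ y)⁻¹ * (y i - x₀ i) = -((gauge x₀ y)⁻¹ * (x₀ i - y i)) := by ring
      constructor
      · rw [hb']; linarith
      · have : 0 ≤ (gauge x₀ y)⁻¹ * (x₀ i - y i) := mul_nonneg (inv_nonneg.2 hτ.le) (by linarith)
        rw [hb']; linarith
  refine ⟨hcoord, ?_⟩
  -- the maximising coordinate lies on a face
  obtain ⟨i, hi⟩ := exists_gauge_eq x₀ y
  refine ⟨i, ?_⟩
  have h0 : 0 < x₀ i := hμ.trans_le (hμ₀ i)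
  have h1 : 0 < 1 - x₀ i := hμ.trans_le (hμ₁ i)
  rw [proj_apply]
  unfold ratio at hi
  rcases max_choice ((y i - x₀ i) / (1 - x₀ i)) ((x₀ i - y i) / x₀ i) with hm | hm <;> rw [hm] at hi
  · right
    rw [hi]
    have : y i - x₀ i ≠ 0 := by
      intro h; rw [h, zero_div] at hi; exact hτ.ne' hi
    field_simp
    ring
  · left
    rw [hi]
    have : x₀ i - y i ≠ 0 := by
      intro h; rw [h, zero_div] at hi; exact hτ.ne' hi
    field_simp
    ring

/-- **`π = id` on `∂H`** ((11.12): the extension agrees with the datum on `∂H`). [cite: Federbush1988PhaseCellIV, (11.12) p. 338;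
(A.35) p. 343] -/
theorem proj_eq_self {y : Euc k} (hy : y ∈ cubeBoundary k) : proj x₀ y = y := by
  rw [proj, gauge_eq_one hμ hμ₀ hμ₁ hy, inv_one, one_smul, add_sub_cancel]

/-- **`π` is Lipschitz away from `x₀`:** for `|y − x₀|, |y′ − x₀| ≥ a > 0`,
`|π(y) − π(y′)| ≤ (√k/a)(1 + √k/μ)|y − y′|`. [cite: Federbush1988PhaseCellIV, (A.38) p. 343; Geometric Construction 6
(11.13) p. 339] -/
theorem dist_proj_le {a : ℝ} (ha : 0 < a) {y y' : Euc k} (hy : a ≤ ‖y - x₀‖) (hy' : a ≤ ‖y' - x₀‖) :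
    dist (proj x₀ y) (proj x₀ y') ≤ Real.sqrt k / a * (1 + Real.sqrt k / μ) * dist y y' := by
  have hk : 0 < Real.sqrt k := Real.sqrt_pos.2 (by exact_mod_cast Nat.pos_of_ne_zero (NeZero.ne k))
  set τ := gauge x₀ y with hτ_def
  set τ' := gauge x₀ y' with hτ'_def
  have hτ0 : a / Real.sqrt k ≤ τ := le_gauge_of_le_norm hμ hμ₀ hμ₁ hy
  have hτ'0 : a / Real.sqrt k ≤ τ' := le_gauge_of_le_norm hμ hμ₀ hμ₁ hy'
  have hq : 0 < a / Real.sqrt k := div_pos ha hk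
  have hτ : 0 < τ := hq.trans_le hτ0
  have hτ' : 0 < τ' := hq.trans_le hτ'0
  have hdiff : proj x₀ y - proj x₀ y' = τ⁻¹ • (y - y') + (τ⁻¹ - τ'⁻¹) • (y' - x₀) := by
    simp only [proj, ← hτ_def, ← hτ'_def, smul_sub, sub_smul]
    abel
  rw [dist_eq_norm, hdiff, dist_eq_norm]
  have h1 : ‖τ⁻¹ • (y - y')‖ ≤ (Real.sqrt k / a) * ‖y - y'‖ := by
    rw [norm_smul, norm_inv, Real.norm_eq_abs, abs_of_pos hτ]
    refine mul_le_mul_of_nonneg_right ?_ (norm_nonneg _)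
    calc τ⁻¹ ≤ (a / Real.sqrt k)⁻¹ := (inv_le_inv₀ hτ hq).2 hτ0
      _ = Real.sqrt k / a := by rw [inv_div]
  have h2 : ‖(τ⁻¹ - τ'⁻¹) • (y' - x₀)‖ ≤ (Real.sqrt k / a) * (Real.sqrt k / μ) * ‖y - y'‖ := by
    rw [norm_smul, Real.norm_eq_abs]
    have hinv : |τ⁻¹ - τ'⁻¹| = |τ - τ'| / (τ * τ') := by
      rw [inv_sub_inv hτ.ne' hτ'.ne', abs_div, abs_of_pos (mul_pos hτ hτ'), ← abs_neg, neg_sub]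
    rw [hinv]
    have h3 : |τ - τ'| ≤ μ⁻¹ * ‖y - y'‖ := abs_gauge_sub_gauge_le hμ hμ₀ hμ₁ y y'
    have h4 : ‖y' - x₀‖ ≤ Real.sqrt k * τ' := norm_sub_le_sqrt_mul_gauge hμ hμ₀ hμ₁ y'
    calc |τ - τ'| / (τ * τ') * ‖y' - x₀‖ ≤ (μ⁻¹ * ‖y - y'‖) / (τ * τ') * (Real.sqrt k * τ') := by
          gcongr
      _ = τ⁻¹ * (Real.sqrt k / μ) * ‖y - y'‖ := by field_simp
      _ ≤ (Real.sqrt k / a) * (Real.sqrt k / μ) * ‖y - y'‖ := by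
          have : τ⁻¹ ≤ Real.sqrt k / a := by
            calc τ⁻¹ ≤ (a / Real.sqrt k)⁻¹ := (inv_le_inv₀ hτ hq).2 hτ0
              _ = Real.sqrt k / a := by rw [inv_div]
          gcongr
  calc ‖τ⁻¹ • (y - y') + (τ⁻¹ - τ'⁻¹) • (y' - x₀)‖ ≤ ‖τ⁻¹ • (y - y')‖ + ‖(τ⁻¹ - τ'⁻¹) • (y' - x₀)‖ := norm_add_le _ _
    _ ≤ (Real.sqrt k / a) * ‖y - y'‖ + (Real.sqrt k / a) * (Real.sqrt k / μ) * ‖y - y'‖ := add_le_add h1 h2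
    _ = Real.sqrt k / a * (1 + Real.sqrt k / μ) * ‖y - y'‖ := by ring

/-- **`π` is Lipschitz on `{|y − x₀| ≥ a}`** with the constant `(√k/a)(1 + √k/μ)` (as an `ℝ≥0`).
[cite: Federbush1988PhaseCellIV, (A.38) p. 343; (11.13) p. 339] -/
theorem lipschitzOnWith_proj {a : ℝ} (ha : 0 < a) :
    LipschitzOnWith (Real.toNNReal (Real.sqrt k / a * (1 + Real.sqrt k / μ))) (proj x₀) {y | a ≤ ‖y - x₀‖} := by
  refine LipschitzOnWith.of_dist_le_mul fun y hy y' hy' => ?_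
  rw [Real.coe_toNNReal _ (by positivity)]
  exact dist_proj_le hμ hμ₀ hμ₁ ha hy hy'

end Gauge

/-! ## §3 A McShane-type extension for data on any subset -/

/-- «view `f` as a map … into `R^t`» and extend it from an arbitrary subset to all of `ℝᵏ` keeping a Lipschitz bound (Mathlib's
finite-dimensional extension, constant `L_t·Λ₁`). [cite: Federbush1988PhaseCellIV, proof of Theorem A.3 p. 342; (A.38) p. 343] -/
theorem exists_lipschitz_extension_of_set {t : ℕ} {s : Set (Euc k)} {M : Set (Euc t)} (f : ↥s → ↥M) {K : ℝ≥0}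
    (hf : LipschitzWith K f) : ∃ g : Euc k → Euc t, LipschitzWith (lipschitzExtensionConstant (Euc t) * K) g ∧
      ∀ x : ↥s, g x = (f x : Euc t) := by
  classical
  set g₁ : Euc k → Euc t := fun x => if hx : x ∈ s then (f ⟨x, hx⟩ : Euc t) else 0 with hg₁
  have hg₁L : LipschitzOnWith K g₁ s := by
    intro x hx y hy
    simp only [hg₁, dif_pos hx, dif_pos hy]
    have := (LipschitzWith.subtype_val M).comp hf
    rw [one_mul] at this
    exact this.edist_le_mul ⟨x, hx⟩ ⟨y, hy⟩
  obtain ⟨g, hg, heq⟩ := hg₁L.extend_finite_dimension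
  refine ⟨g, hg, fun x => ?_⟩
  have := heq x.2
  simp only [hg₁, dif_pos x.2] at this
  exact this.symm

end CubeRadial

end

end Literature.MathematicalPhysics.QuantumFieldTheory.Federbush1986
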